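import Mathlib
import HarnessLib
import Summits.HubbardSuperconductivity.HubbardSuperconductivity.Theorems.KLProgrammeKLRegimeEngineTowerRemeasureUmklappSplit
import Summits.HubbardSuperconductivity.HubbardSuperconductivity.Theorems.KLProgrammeH10TwoPointLimitKlAnisoOffOrWideCount
import Summits.HubbardSuperconductivity.HubbardSuperconductivity.Theorems.KLProgrammeH10TwoPointLimitKlAnisoNarrowConeCountSummed

/-!
# Route `KLProgramme` — crux K3 ENGINE (stmt-HubbardSuperconductivity-20437 `KLRegimeEngineV17F2`), stub (b) v2, THE LEVELS PACKAGE (ℓ), (I2) jump half: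
# THE NARROW / WIDE SPLIT OF THE UMKLAPP-ACTIVE CLASS WITH ALL THREE COUNTS DISCHARGED — the consumer side of located item «ON-CLASS-KB»
# (p4 g13's recipe HOME/prover-p4/CLAIM-U-API.md §3c `B := ON ∩ NARROW(Θ)`; cell gate-hubbard-kl, seat hubbard-kl-k3c2-p3 g11)

`…EngineTowerRemeasureUmklappSplit` (p591605) splits the coarse label tuples into OFF / ON the umklapp-active class and pays the one-determined-leg count on the
whole ON class.  p4 g13 refined the ON class: by the dichotomy `wide_or_narrowCone` a tuple on the class of some `G₀ ≠ 0` is either WIDE (two free legs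
transversal ⇒ the `(m+1)−3` count survives, `PerturbedFermiCurve.card_relCount_prescribed_offOrWide_klAniso_le_window`) or NARROW about the pinned leg (all other
legs in a cone of `⌊(Θ+5w_k)/w_k⌋` sectors modulo `2^k`), and the narrow class has a `k`-UNIFORM coarse multiplicity per pinned label
(`PerturbedFermiCurve.card_onNarrow_pinned_le_window`).  Since the narrow condition refers to the pinned leg, the class is LEG-DEPENDENT; this file therefore

* §1 re-proves the levelled split brick for a leg-dependent class `B : Fin (m+1) → Finset _` with the on-class input in PINNED-SUM shape
  (**`klLevNormOf_jump_le_split_of_consts_legClass`**, same proof as `…_pinned`);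
* §2 bounds a pinned class sum by (multiplicity) × (single-tuple pinned sums) and a single-tuple pinned sum by the FULLY PRESCRIBED levelled norm
  (`pinnedClassSum_le_card_mul`, `pinnedTupleSum_le_klLevNormOf_full`, `levelCount_some_comp`);
* §3 **`klLevNormOf_jump_le_narrowWideSplit_klEng m (hm : 3 ≤ m)`** — `∃` (jump constant, the off/wide rows' `C D₁ Cw c₂ cb K₁ K₂ c₀ c₂′`, the last-leg `D₂`, `k₀`),
  `∀ R (R.WF2) ∃ c₃ U₀ Λ r₀ v₀`, then under the stub binders, `k₀ ≤ k`, `k + 1 ≤ J′ ≤ nScales β + 1`, a transversality radius `Θ` in the wide row's regime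
  (`LΨ, B_fib` at wedge budget `π/2`) and the three scale conditions `(m+1)(Cw + C)w_k < 2π`, `((m+1)C + mΛC′)w_k < v₀`, `(m+1)Cw_k < π` (`C′ = ⌊(Θ+5w_k)/w_k⌋`):
  for momentum-conserving `T`, with `N` a bound on the coarse levelled norms of level `F = levelCount Ωe` and `N_f` a bound on the coarse FULLY PRESCRIBED norms
  (level `m+1`),
  `klLevNormOf … J′ (m+1) T Ωe ≤ C_m·(27^{F+1}·(D₁^{m+1} + 5^{m+1}(m+1)²·B_fib·3^{m−2})·(2^{J′−k})^{m−2}·N + D₂·27^{m+1}·(2^{J′−k})^{m−F}·Mult·N_f)`,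
  `Mult = (2m+3)²·2(8π((m+1)C + mΛC′)/r₀ + 2)·(8(2C′+1))^m` — the on-class loss now multiplies only the fully prescribed born sizes (maximal level gain in E1's law)
  at a `k`-uniform multiplicity.  REGIME NOTE (p4, honest): both rows are good iff `Θ_min ≲ w_k`; the graded middle ground `Θ_min ≫ w_k` is E1's «G1-L-GRADED» question —
  here `Θ`, `LΨ`, `B_fib` are free parameters and nothing is chosen.
The weighted twin at the flow frame (p3's deep window) is the companion file `…EngineTowerRemeasureNarrowWideSplitWt`.
Everything is proved; no definitions; nothing about the model is asserted; nothing asserts superconductivity.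
References: BGM 2006 §2.8 (2.82)–(2.84), (2.88)–(2.90), App. A3 Lemma A3.1; BGM 2003 §3.1 Lemma 3.1, §7.4 [cite: BenfattoGiulianiMastropietro2006; BenfattoGiulianiMastropietro2003].
-/

noncomputable section

namespace Summit.HubbardSuperconductivity.HubbardSuperconductivity.Theorems.EngineV8

set_option linter.dupNamespace false -- summit = problem name (single-conjunct summit), D-0017

open Classical
open Real Finset Literature.MathematicalPhysics.QuantumLattice Literature.Probability.LatticeModels GrassmannAlgebra
open Literature.MathematicalPhysics.QuantumLattice.FermiRG
open Summit.HubbardSuperconductivity.HubbardSuperconductivity.Theorems.KLRegimeSplit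
open Summit.HubbardSuperconductivity.HubbardSuperconductivity.Theorems.KLProgrammeLegKernels
open Summit.HubbardSuperconductivity.HubbardSuperconductivity.Theorems.DispersionFlow
open Summit.HubbardSuperconductivity.HubbardSuperconductivity.Theorems.KLRegimeWick
open Summit.HubbardSuperconductivity.HubbardSuperconductivity.Theorems.TorusFourierL2
open Summit.HubbardSuperconductivity.HubbardSuperconductivity.Theorems.PerturbedFermiCurve

variable {L M : ℕ} [NeZero L] [NeZero M]

/-! ## §1 The levelled split brick for a leg-dependent class -/

/-- **THE LEVELLED JUMP, SPLIT FORM, for a LEG-DEPENDENT class `B p`** — as `klLevNormOf_jump_le_split_of_consts_pinned` (same proof), but the class may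
depend on the pinned leg `p` (the narrow-cone condition is relative to it) and the on-class input is taken in PINNED-SUM shape:
`ε^m Σ_{σ′ ∈ B p, σ′ p = ℓ} Σ_{x′ : x′ p = y} ‖W^{F_k}(σ′, x′)‖ ≤ N_B` for every `(p, ℓ, y)`.
[cite: BenfattoGiulianiMastropietro2006, §2.8 (2.82)-(2.84), (2.88)-(2.90), App. A3] -/
theorem klLevNormOf_jump_le_split_of_consts_legClass {β : ℝ} (hβ : 0 < β) (μ : ℝ) (K : TrigPolyC4v) {k J' : ℕ} (hJ : k + 1 ≤ J')
    (T : HubbardGrassmann L M)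
    (hT : ∀ (m : ℕ) (X : Fin m → HubbardFieldIdx L M), ∑ i, signedMomentum L (X i).2 (X i).1.1.2 ≠ 0 → kernel ℂ T m X = 0)
    {c₁ c₁r : ℝ} (hc₁0 : 0 ≤ c₁) (hc₁r0 : 0 ≤ c₁r)
    (hcol₁ : ∀ (ω'' : Fin (sectorCount J')) (ω' : Fin (sectorCount k)) (σ c : Fin 2) (x' : SpaceTimeIdx L M),
      ∑ x'' : SpaceTimeIdx L M, ‖(sectorAnalysisMatrix L M β (klAnisoFamily L M β μ K klE0 J') *
        sectorSubMatrix L M β (bgmFatMultiplier L M klE0 β (nambuXiCT L μ K) k)) (x'', ((ω'', σ), c)) (x', ((ω', σ), c))‖ ≤ c₁)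
    (hrow₁ : ∀ (ω'' : Fin (sectorCount J')) (ω' : Fin (sectorCount k)) (σ c : Fin 2) (x'' : SpaceTimeIdx L M),
      ∑ x' : SpaceTimeIdx L M, ‖(sectorAnalysisMatrix L M β (klAnisoFamily L M β μ K klE0 J') *
        sectorSubMatrix L M β (bgmFatMultiplier L M klE0 β (nambuXiCT L μ K) k)) (x'', ((ω'', σ), c)) (x', ((ω', σ), c))‖ ≤ c₁r)
    (m : ℕ) (B : Fin (m + 1) → Finset (Fin (m + 1) → SectorLeg (sectorCount k))) (Ωe : Fin (m + 1) → Option (SectorLeg (sectorCount J')))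
    {A₁ A₂ N NB : ℝ} (hA₁ : 0 ≤ A₁) (hA₂ : 0 ≤ A₂) (hN0 : 0 ≤ N) (hNB0 : 0 ≤ NB)
    (hRoff : ∀ (E : Finset (Fin (m + 1))) (τ'' : Fin (m + 1) → SectorLeg (sectorCount J')) (σ' : Fin (m + 1) → SectorLeg (sectorCount k))
      (p : Fin (m + 1)), p ∈ E → σ' ∉ B p → levelCount Ωe ≤ E.card → E.card ≤ levelCount Ωe + 1 →
      (27 : ℝ) ^ E.card * ((((bgmSectorSet L M (klAnisoFamily L M β μ K klE0 J') (m + 1)).filter fun σ'' => (∀ e ∈ E, σ'' e = τ'' e) ∧ ∀ i,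
        (∃ q : FreqMomentum L M, klAnisoFamily L M β μ K klE0 J' (σ'' i).1.1 q ≠ 0 ∧
          bgmFatMultiplier L M klE0 β (nambuXiCT L μ K) k (σ' i).1.1 q ≠ 0) ∧
        (σ' i).1.2 = (σ'' i).1.2 ∧ (σ' i).2 = (σ'' i).2).card : ℝ)) ≤ A₁)
    (hRon : ∀ (E : Finset (Fin (m + 1))) (τ'' : Fin (m + 1) → SectorLeg (sectorCount J')) (σ' : Fin (m + 1) → SectorLeg (sectorCount k))
      (p : Fin (m + 1)), p ∈ E → σ' ∈ B p → levelCount Ωe ≤ E.card → E.card ≤ levelCount Ωe + 1 →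
      (27 : ℝ) ^ E.card * ((((bgmSectorSet L M (klAnisoFamily L M β μ K klE0 J') (m + 1)).filter fun σ'' => (∀ e ∈ E, σ'' e = τ'' e) ∧ ∀ i,
        (∃ q : FreqMomentum L M, klAnisoFamily L M β μ K klE0 J' (σ'' i).1.1 q ≠ 0 ∧
          bgmFatMultiplier L M klE0 β (nambuXiCT L μ K) k (σ' i).1.1 q ≠ 0) ∧
        (σ' i).1.2 = (σ'' i).1.2 ∧ (σ' i).2 = (σ'' i).2).card : ℝ)) ≤ A₂)
    (hN : ∀ Ωe' : Fin (m + 1) → Option (SectorLeg (sectorCount k)), levelCount Ωe' = levelCount Ωe →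
      klLevNormOf L M β μ K k (m + 1) T Ωe' ≤ N)
    (hNB : ∀ (p : Fin (m + 1)) (ℓ : SectorLeg (sectorCount k)) (y : SpaceTimeIdx L M),
      imagTimeWeight β M ^ m *
        ∑ σ' ∈ (B p).filter (fun σ' : Fin (m + 1) → SectorLeg (sectorCount k) => σ' p = ℓ),
          ∑ x' ∈ univ.filter (fun x' : Fin (m + 1) → SpaceTimeIdx L M => x' p = y),
            ‖sectorisedKernel L M β (klAnisoFamily L M β μ K klE0 k) T (m + 1) σ' x'‖ ≤ NB) :
    klLevNormOf L M β μ K J' (m + 1) T Ωe ≤ c₁ ^ m * c₁r * imagTimeWeight β M ^ (m + 1) * (A₁ * N + A₂ * NB) := by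
  have hε0 : 0 ≤ imagTimeWeight β M := imagTimeWeight_nonneg hβ.le M
  set ε := imagTimeWeight β M with hεdef
  set F' := klAnisoFamily L M β μ K klE0 J' with hF'
  set Fk := klAnisoFamily L M β μ K klE0 k with hFk
  have hC : 0 ≤ c₁ ^ m * c₁r * ε ^ (m + 1) * (A₁ * N + A₂ * NB) := by positivity
  rw [klLevNormOf, hubbardSectorKernelNorm_def]
  refine sectorisedKernelNorm_le_of_forall_le hC fun p s x => ?_
  -- the leg set and the fine prescription read by the leg sum at `(p, s)`
  set E : Finset (Fin (m + 1)) := univ.filter fun i => (Ωe i).isSome ∨ i = p with hE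
  set τ'' : Fin (m + 1) → SectorLeg (sectorCount J') := fun i => (Ωe i).getD s with hτ''
  have hpE : p ∈ E := by simp [hE]
  have hEdom : ∀ i, (Ωe i).isSome → i ∈ E := fun i hi => by simp [hE, hi]
  have hFE : levelCount Ωe ≤ E.card := levelCount_le_card_legSet Ωe p
  have hEF : E.card ≤ levelCount Ωe + 1 := card_legSet_le_levelCount_succ Ωe p
  have h27 : (0 : ℝ) < (27 : ℝ) ^ E.card := by positivity
  -- (1) the leg sum is dominated by the `E`-prescribed fine sum over `bgmSectorSet`
  have h1 : sectorLegSum ε (prescribedTuples (bgmSectorSet L M F' (m + 1)) Ωe) (sectorisedKernel L M β F' T (m + 1)) p s x ≤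
      ε ^ m * ∑ σ'' ∈ (bgmSectorSet L M F' (m + 1)).filter (fun σ'' => ∀ e ∈ E, σ'' e = τ'' e),
        ∑ x'' ∈ univ.filter (fun x'' : Fin (m + 1) → SpaceTimeIdx L M => x'' p = x),
          ‖sectorisedKernel L M β F' T (m + 1) σ'' x''‖ := by
    rw [sectorLegSum_def, ← mul_sum]
    refine mul_le_mul_of_nonneg_left (sum_le_sum_of_subset_of_nonneg ?_ fun _ _ _ => sum_nonneg fun _ _ => norm_nonneg _)
      (pow_nonneg hε0 m)
    intro Ω hΩ
    simp only [prescribedTuples, mem_filter] at hΩ ⊢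
    refine ⟨hΩ.1.1, fun e he => ?_⟩
    have he' : (Ωe e).isSome ∨ e = p := by simpa [hE] using he
    rcases he' with he' | rfl
    · obtain ⟨ℓ, hℓ⟩ := Option.isSome_iff_exists.1 he'
      rw [hτ'']
      simp only [hℓ, Option.getD_some]
      exact hΩ.1.2 e ℓ (by simp [hℓ])
    · show Ω e = (Ωe e).getD s
      rcases hcase : Ωe e with _ | ℓ
      · simpa using hΩ.2
      · simp only [Option.getD_some]
        exact hΩ.1.2 e ℓ (by simp [hcase])
  -- (2) the coarse `E`-prescribed sums over ALL tuples are dominated by the coarse levelled norms of the same level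
  have hN₁ : ∀ (τ' : Fin (m + 1) → SectorLeg (sectorCount k)) (y : SpaceTimeIdx L M),
      ε ^ m * ∑ σ' ∈ univ.filter (fun σ' : Fin (m + 1) → SectorLeg (sectorCount k) => ∀ e ∈ E, σ' e = τ' e),
        ∑ x' ∈ univ.filter (fun x' : Fin (m + 1) → SpaceTimeIdx L M => x' p = y),
          ‖sectorisedKernel L M β Fk T (m + 1) σ' x'‖ ≤ N := by
    intro τ' y
    have hlev : levelCount (fun i => (Ωe i).map fun _ => τ' i) = levelCount Ωe := levelCount_map_const Ωe τ'
    have hsub : (bgmSectorSet L M Fk (m + 1)).filter (fun σ' : Fin (m + 1) → SectorLeg (sectorCount k) => ∀ e ∈ E, σ' e = τ' e) ⊆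
        univ.filter (fun σ' : Fin (m + 1) → SectorLeg (sectorCount k) => ∀ e ∈ E, σ' e = τ' e) :=
      filter_subset_filter _ (subset_univ _)
    rw [← Finset.sum_subset hsub fun σ' hσ'univ hσ'not => ?_]
    · refine (sum_prescribed_le_sectorLegSum_prescribedTuples hε0 (sectorisedKernel L M β Fk T (m + 1)) _ Ωe p E hEdom hpE τ' y).trans ?_
      refine (sectorLegSum_le_sectorisedKernelNorm ε _ _ p (τ' p) y).trans ?_
      have h := hN _ hlev
      rwa [klLevNormOf, hubbardSectorKernelNorm_def] at h
    · have hP := (mem_filter.1 hσ'univ).2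
      have hnot : σ' ∉ bgmSectorSet L M Fk (m + 1) := fun h => hσ'not (mem_filter.2 ⟨h, hP⟩)
      exact sum_eq_zero fun x' _ => by rw [sectorisedKernel_eq_zero_of_not_mem_bgmSectorSet β Fk T hT hnot x', norm_zero]
  -- (3) the coarse `E`-prescribed sums over the class `B p` are dominated by the pinned class sums
  have hN₂ : ∀ (τ' : Fin (m + 1) → SectorLeg (sectorCount k)) (y : SpaceTimeIdx L M),
      ε ^ m * ∑ σ' ∈ (B p).filter (fun σ' : Fin (m + 1) → SectorLeg (sectorCount k) => ∀ e ∈ E, σ' e = τ' e),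
        ∑ x' ∈ univ.filter (fun x' : Fin (m + 1) → SpaceTimeIdx L M => x' p = y),
          ‖sectorisedKernel L M β Fk T (m + 1) σ' x'‖ ≤ NB := by
    intro τ' y
    refine le_trans (mul_le_mul_of_nonneg_left (sum_le_sum_of_subset_of_nonneg (fun σ' hσ' => ?_)
      fun _ _ _ => sum_nonneg fun _ _ => norm_nonneg _) (pow_nonneg hε0 m)) (hNB p (τ' p) y)
    simp only [mem_filter] at hσ' ⊢
    exact ⟨hσ'.1, hσ'.2 p hpE⟩
  -- (4) the re-sectorisation lemma with the class `B p`
  have hR₁0 : 0 ≤ A₁ / (27 : ℝ) ^ E.card := div_nonneg hA₁ h27.le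
  have hR₂0 : 0 ≤ A₂ / (27 : ℝ) ^ E.card := div_nonneg hA₂ h27.le
  have h2 := hubbardSectorPrescribedSum_klAniso_jump_le_split (L := L) (M := M) hβ μ K hJ T hc₁0 hc₁r0 hR₁0 hR₂0 hN0 hNB0 hcol₁ hrow₁ m
    (bgmSectorSet L M F' (m + 1)) (B p) E τ'' p hpE
    (fun σ' hσ' => by rw [le_div_iff₀ h27, mul_comm]; exact hRoff E τ'' σ' p hpE hσ' hFE hEF)
    (fun σ' hσ' => by rw [le_div_iff₀ h27, mul_comm]; exact hRon E τ'' σ' p hpE hσ' hFE hEF) hN₁ hN₂ x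
  -- (5) assemble
  refine h1.trans (h2.trans (le_of_eq ?_))
  field_simp
  ring

/-! ## §2 Pinned class sums: multiplicity × fully prescribed norms -/

omit [NeZero M] in
/-- A pinned class sum is at most the class's pinned multiplicity times a uniform bound on the single-tuple pinned sums. -/
theorem pinnedClassSum_le_card_mul {ε : ℝ} {m Nk : ℕ} (W : (Fin (m + 1) → SectorLeg Nk) → (Fin (m + 1) → SpaceTimeIdx L M) → ℂ)
    (Bp : Finset (Fin (m + 1) → SectorLeg Nk)) (p : Fin (m + 1)) (ℓ : SectorLeg Nk) (y : SpaceTimeIdx L M) {Nf : ℝ}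
    (hNf : ∀ σ' ∈ Bp.filter (fun σ' : Fin (m + 1) → SectorLeg Nk => σ' p = ℓ),
      ε ^ m * ∑ x' ∈ univ.filter (fun x' : Fin (m + 1) → SpaceTimeIdx L M => x' p = y), ‖W σ' x'‖ ≤ Nf) :
    ε ^ m * ∑ σ' ∈ Bp.filter (fun σ' : Fin (m + 1) → SectorLeg Nk => σ' p = ℓ),
        ∑ x' ∈ univ.filter (fun x' : Fin (m + 1) → SpaceTimeIdx L M => x' p = y), ‖W σ' x'‖ ≤
      ((Bp.filter fun σ' : Fin (m + 1) → SectorLeg Nk => σ' p = ℓ).card : ℝ) * Nf := by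
  rw [mul_sum]
  refine (sum_le_sum hNf).trans (le_of_eq ?_)
  rw [sum_const, nsmul_eq_mul]

omit [NeZero L] [NeZero M] in
/-- The all-`some` prescription has level `m + 1`. -/
theorem levelCount_some_comp {m N : ℕ} (σ' : Fin (m + 1) → SectorLeg N) : levelCount (fun i => some (σ' i)) = m + 1 := by
  simp [levelCount]

omit [NeZero M] in
/-- **A single-tuple pinned sum is at most the FULLY PRESCRIBED levelled norm** (momentum-conserving `T`; off `bgmSectorSet` the kernel vanishes). -/
theorem pinnedTupleSum_le_klLevNormOf_full {β : ℝ} (hβ : 0 < β) (μ : ℝ) (K : TrigPolyC4v) (k : ℕ) (T : HubbardGrassmann L M)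
    (hT : ∀ (m : ℕ) (X : Fin m → HubbardFieldIdx L M), ∑ i, signedMomentum L (X i).2 (X i).1.1.2 ≠ 0 → kernel ℂ T m X = 0)
    {m : ℕ} (σ' : Fin (m + 1) → SectorLeg (sectorCount k)) (p : Fin (m + 1)) (y : SpaceTimeIdx L M) :
    imagTimeWeight β M ^ m * ∑ x' ∈ univ.filter (fun x' : Fin (m + 1) → SpaceTimeIdx L M => x' p = y),
        ‖sectorisedKernel L M β (klAnisoFamily L M β μ K klE0 k) T (m + 1) σ' x'‖ ≤
      klLevNormOf L M β μ K k (m + 1) T (fun i => some (σ' i)) := by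
  have hε0 : 0 ≤ imagTimeWeight β M := imagTimeWeight_nonneg hβ.le M
  set Fk := klAnisoFamily L M β μ K klE0 k with hFk
  by_cases hmem : σ' ∈ bgmSectorSet L M Fk (m + 1)
  · rw [klLevNormOf, hubbardSectorKernelNorm_def]
    refine le_trans ?_ (sectorLegSum_le_sectorisedKernelNorm _ _ _ p (σ' p) y)
    rw [sectorLegSum_def]
    have hσmem : σ' ∈ (prescribedTuples (bgmSectorSet L M Fk (m + 1)) (fun i => some (σ' i))).filter
        (fun Ω : Fin (m + 1) → SectorLeg (sectorCount k) => Ω p = σ' p) := by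
      simp only [prescribedTuples, mem_filter, Option.mem_def, Option.some.injEq, forall_eq', implies_true, and_true]
      exact hmem
    exact single_le_sum (s := (prescribedTuples (bgmSectorSet L M Fk (m + 1)) (fun i => some (σ' i))).filter
        (fun Ω : Fin (m + 1) → SectorLeg (sectorCount k) => Ω p = σ' p))
      (f := fun Ω => imagTimeWeight β M ^ m * ∑ x' ∈ univ.filter (fun x' : Fin (m + 1) → SpaceTimeIdx L M => x' p = y),
        ‖sectorisedKernel L M β Fk T (m + 1) Ω x'‖) (fun _ _ => by positivity) hσmem
  · have hzero : ∑ x' ∈ univ.filter (fun x' : Fin (m + 1) → SpaceTimeIdx L M => x' p = y),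
        ‖sectorisedKernel L M β Fk T (m + 1) σ' x'‖ = 0 :=
      sum_eq_zero fun x' _ => by rw [sectorisedKernel_eq_zero_of_not_mem_bgmSectorSet β Fk T hT hmem x', norm_zero]
    rw [hzero, mul_zero]
    exact klLevNormOf_nonneg hβ.le μ K k (m + 1) T _

omit [NeZero M] in
/-- **The pinned sum over a class is at most (pinned multiplicity) × (bound on the fully prescribed levelled norms).** -/
theorem pinnedClassSum_le_card_mul_of_full {β : ℝ} (hβ : 0 < β) (μ : ℝ) (K : TrigPolyC4v) (k : ℕ) (T : HubbardGrassmann L M)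
    (hT : ∀ (m : ℕ) (X : Fin m → HubbardFieldIdx L M), ∑ i, signedMomentum L (X i).2 (X i).1.1.2 ≠ 0 → kernel ℂ T m X = 0)
    {m : ℕ} (Bp : Finset (Fin (m + 1) → SectorLeg (sectorCount k))) (p : Fin (m + 1)) (ℓ : SectorLeg (sectorCount k)) (y : SpaceTimeIdx L M)
    {Nf : ℝ} (hNf : ∀ Ωf : Fin (m + 1) → Option (SectorLeg (sectorCount k)), levelCount Ωf = m + 1 → klLevNormOf L M β μ K k (m + 1) T Ωf ≤ Nf) :
    imagTimeWeight β M ^ m * ∑ σ' ∈ Bp.filter (fun σ' : Fin (m + 1) → SectorLeg (sectorCount k) => σ' p = ℓ),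
        ∑ x' ∈ univ.filter (fun x' : Fin (m + 1) → SpaceTimeIdx L M => x' p = y),
          ‖sectorisedKernel L M β (klAnisoFamily L M β μ K klE0 k) T (m + 1) σ' x'‖ ≤
      ((Bp.filter fun σ' : Fin (m + 1) → SectorLeg (sectorCount k) => σ' p = ℓ).card : ℝ) * Nf :=
  pinnedClassSum_le_card_mul _ Bp p ℓ y fun σ' _ =>
    (pinnedTupleSum_le_klLevNormOf_full hβ μ K k T hT σ' p y).trans (hNf _ (levelCount_some_comp σ'))

omit [NeZero L] [NeZero M] in
/-- `a · Σ_{i ∈ S} g i ≤ |S| · N_f` when every `a · g i ≤ N_f`. -/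
theorem mul_sum_le_card_mul {ι : Type*} (S : Finset ι) (g : ι → ℝ) {a Nf : ℝ} (h : ∀ i ∈ S, a * g i ≤ Nf) :
    a * ∑ i ∈ S, g i ≤ (S.card : ℝ) * Nf := by
  rw [mul_sum]
  refine (sum_le_sum h).trans (le_of_eq ?_)
  rw [sum_const, nsmul_eq_mul]

/-! ## §3 The levelled jump, narrow / wide split, all counts discharged -/

omit [NeZero L] [NeZero M] in
/-- Off-or-wide count arithmetic: for `|E| ≤ F + 1`, `3 ≤ m`, `0 ≤ D`, `0 ≤ B`:
`27^{|E|}·(D^{m+1}·2^{Δ((m+1)−3)} + 5^{m+1}((m+1)²(B(3·2^Δ)^{(m+1)−3}))) ≤ 27^{F+1}·(D^{m+1} + 5^{m+1}((m+1)²(B·3^{m−2})))·(2^Δ)^{m−2}`. -/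
theorem offOrWide_count_arith {D B : ℝ} (hD : 0 ≤ D) (hB : 0 ≤ B) (Δ m F e : ℕ) (hm : 3 ≤ m) (heF : e ≤ F + 1) :
    (27 : ℝ) ^ e * (D ^ (m + 1) * (2 : ℝ) ^ (Δ * ((m + 1) - 3)) + (5 : ℝ) ^ (m + 1) * ((m + 1 : ℕ) ^ 2 * (B * (3 * (2 : ℝ) ^ Δ) ^ ((m + 1) - 3)))) ≤
      (27 : ℝ) ^ (F + 1) * (D ^ (m + 1) + (5 : ℝ) ^ (m + 1) * ((m + 1 : ℕ) ^ 2 * (B * 3 ^ (m - 2)))) * ((2 : ℝ) ^ Δ) ^ (m - 2) := by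
  have hexp : (m + 1) - 3 = m - 2 := by omega
  rw [hexp, pow_mul, mul_pow]
  have h27 : (27 : ℝ) ^ e ≤ 27 ^ (F + 1) := pow_le_pow_right₀ (by norm_num) heF
  have hX : 0 ≤ (D ^ (m + 1) + (5 : ℝ) ^ (m + 1) * ((m + 1 : ℕ) ^ 2 * (B * 3 ^ (m - 2)))) * ((2 : ℝ) ^ Δ) ^ (m - 2) := by positivity
  calc (27 : ℝ) ^ e * (D ^ (m + 1) * ((2 : ℝ) ^ Δ) ^ (m - 2) + (5 : ℝ) ^ (m + 1) * ((m + 1 : ℕ) ^ 2 * (B * ((3 : ℝ) ^ (m - 2) * ((2 : ℝ) ^ Δ) ^ (m - 2)))))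
      = (27 : ℝ) ^ e * ((D ^ (m + 1) + (5 : ℝ) ^ (m + 1) * ((m + 1 : ℕ) ^ 2 * (B * 3 ^ (m - 2)))) * ((2 : ℝ) ^ Δ) ^ (m - 2)) := by ring
    _ ≤ 27 ^ (F + 1) * ((D ^ (m + 1) + (5 : ℝ) ^ (m + 1) * ((m + 1 : ℕ) ^ 2 * (B * 3 ^ (m - 2)))) * ((2 : ℝ) ^ Δ) ^ (m - 2)) :=
        mul_le_mul_of_nonneg_right h27 hX
    _ = _ := by ring

/-- **THE LEVELLED JUMP, NARROW / WIDE SPLIT OF THE UMKLAPP-ACTIVE CLASS, ALL COUNTS DISCHARGED** (`m + 1 ≥ 4` legs).  Class (leg-dependent):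
`B p = {σ′ : (∃ G₀ ≠ 0, σ′ on the umklapp class of G₀ at tolerance (m+1)Cw_k) ∧ (∃ b, ∀ i ≠ p, leg i within ⌊(Θ+5w_k)/w_k⌋ sectors of b modulo 2^k)}`;
OFF `B p` = off the class OR wide ⇒ `(m+1)−3` count (p4 `…offOrWide…`); ON `B p` ⇒ one-determined-leg count (`…lastLeg…`) against the pinned class sums, which are
`≤` (narrow multiplicity, p4 `card_onNarrow_pinned_le_window`) × (fully prescribed coarse norms `≤ N_f`).
[cite: BenfattoGiulianiMastropietro2006, §2.8 (2.82)-(2.84), (2.88)-(2.90), App. A3] -/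
theorem klLevNormOf_jump_le_narrowWideSplit_klEng (m : ℕ) (hm : 3 ≤ m) :
    ∃ Cm : ℝ, 0 < Cm ∧ ∃ C : ℝ, 0 < C ∧ ∃ D₁ : ℝ, 0 < D₁ ∧ ∃ Cw : ℝ, 0 < Cw ∧
      ∃ c₂ cb K₁ K₂ c₀ c₂' : ℝ, 0 ≤ c₂ ∧ 0 < cb ∧ 2 + c₂ ≤ K₁ ∧ 0 < K₂ ∧ 0 < c₀ ∧ 0 < c₂' ∧
      ∃ D₂ : ℝ, 0 < D₂ ∧ ∃ k₀ : ℕ,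
      ∀ R : RenConsts, R.WF2 → ∃ c₃ : ℝ, 0 < c₃ ∧ ∃ U₀ : ℝ, 0 < U₀ ∧ ∃ Λ : ℝ, 0 ≤ Λ ∧ ∃ r₀ : ℝ, 0 < r₀ ∧ ∃ v₀ : ℝ, 0 < v₀ ∧
      ∀ (P : SplitConsts) (c : ℝ), P.WF → 0 < c → c ≤ klEngC₃6 P R → c ≤ c₃ →
      ∀ μ ∈ klWindowC, ∀ U : ℝ, 0 < U → U ≤ klEngU₀9 P R c → U ≤ U₀ → ∀ β : ℝ, klBetaMin ≤ β → β ≤ Real.exp (c / U ^ 2) →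
      ∀ K : TrigPolyC4v, FrameOK R U (nScales β) μ K → ∀ (L M : ℕ) [NeZero L] [NeZero M],
      klEngL₃ β U ≤ L → klEngM₃ β U L ≤ M → ∀ k J' : ℕ, k₀ ≤ k → k + 1 ≤ J' → J' ≤ nScales β + 1 →
      ∀ (Θ LΨ Bfib : ℝ), LΨ = (m + 1 : ℕ) + c₂ * (π / 2 + 5 * sectorWidth k) / (K₁ * Θ) → (2 : ℝ) ^ (-(J' : ℤ)) ≤ Θ →
        cb * (2 : ℝ) ^ (-(J' : ℤ)) ≤ Θ → K₂ * LΨ * (cb * (2 : ℝ) ^ (-(J' : ℤ))) ≤ c₂' * Θ →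
        max ((2 * ((2 * c₀ * K₂ * cb / π + 1) * LΨ)) ^ 2) (4 * cb ^ 2 * K₂ ^ 2 / 1 ^ 2 * LΨ ^ 2) ≤ Bfib →
      ((m : ℝ) + 1) * (Cw + C) * sectorWidth k < 2 * π →
      (((m : ℝ) + 1) * C + m * Λ * (⌊(Θ + 5 * sectorWidth k) / sectorWidth k⌋₊ : ℕ)) * sectorWidth k < v₀ →
      ((m : ℝ) + 1) * C * sectorWidth k < π →
      ∀ T : HubbardGrassmann L M,
        (∀ (m' : ℕ) (X : Fin m' → HubbardFieldIdx L M), ∑ i, signedMomentum L (X i).2 (X i).1.1.2 ≠ 0 → kernel ℂ T m' X = 0) →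
      ∀ (Ωe : Fin (m + 1) → Option (SectorLeg (sectorCount J'))) (N Nf : ℝ), 0 ≤ N → 0 ≤ Nf →
        (∀ Ωe' : Fin (m + 1) → Option (SectorLeg (sectorCount k)), levelCount Ωe' = levelCount Ωe →
          klLevNormOf L M β μ K k (m + 1) T Ωe' ≤ N) →
        (∀ Ωf : Fin (m + 1) → Option (SectorLeg (sectorCount k)), levelCount Ωf = m + 1 →
          klLevNormOf L M β μ K k (m + 1) T Ωf ≤ Nf) →
        klLevNormOf L M β μ K J' (m + 1) T Ωe ≤
          Cm * ((27 : ℝ) ^ (levelCount Ωe + 1) * (D₁ ^ (m + 1) + (5 : ℝ) ^ (m + 1) * ((m + 1 : ℕ) ^ 2 * (Bfib * 3 ^ (m - 2)))) *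
              ((2 : ℝ) ^ (J' - k)) ^ (m - 2) * N +
            D₂ * 27 ^ (m + 1) * ((2 : ℝ) ^ (J' - k)) ^ (m - levelCount Ωe) *
              ((2 * ((m : ℝ) + 1) + 1) ^ 2 * (2 * (8 * π * (((m : ℝ) + 1) * C + m * Λ * (⌊(Θ + 5 * sectorWidth k) / sectorWidth k⌋₊ : ℕ)) / r₀ + 2) *
                (8 * (2 * ((⌊(Θ + 5 * sectorWidth k) / sectorWidth k⌋₊ : ℕ) : ℝ) + 1)) ^ m)) * Nf) := by
  obtain ⟨CJ, hCJ, hov⟩ := overlap_jump_sums_klEng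
  obtain ⟨C, hC, D₁, hD₁, Cw, hCw, c₂, cb, K₁, K₂, c₀, c₂', h1, h2, h3, h4, h5, h6, k₀, hoffR⟩ :=
    card_relCount_prescribed_offOrWide_klAniso_le_window
  obtain ⟨D₂, hD₂, honR⟩ := card_relCount_prescribed_lastLeg_klAniso_le_window m
  refine ⟨(3 * CJ / 2) ^ (m + 1), by positivity, C, hC, D₁, hD₁, Cw, hCw, c₂, cb, K₁, K₂, c₀, c₂', h1, h2, h3, h4, h5, h6, D₂, hD₂, k₀,
    fun R hR2 => ?_⟩
  have hRj : ∀ j, 0 ≤ R.Gfr j := gfr_nonneg_of_wf2 hR2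
  obtain ⟨c₃, hc₃, U₀, hU₀, hoff'⟩ := hoffR R hRj
  obtain ⟨c₃', hc₃', U₀', hU₀', hon'⟩ := honR R hRj
  obtain ⟨c₃'', hc₃'', U₀'', hU₀'', Λ, hΛ, r₀, hr₀, v₀, hv₀, hmult⟩ := card_onNarrow_pinned_le_window R hRj
  refine ⟨min (min c₃ c₃') c₃'', lt_min (lt_min hc₃ hc₃') hc₃'', min (min U₀ U₀') U₀'', lt_min (lt_min hU₀ hU₀') hU₀'', Λ, hΛ, r₀, hr₀, v₀, hv₀, ?_⟩
  intro P c hP hc hc6 hcm μ hμ U hU hU9 hUm β hβmin hβc K hK L M _ _ hL3 hM3 k J' hk₀ hJ hJN Θ LΨ Bfib hLΨ hΘt hΘδ hΘη hBfib hsmall hsmallv hπC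
    T hT Ωe N Nf hN0 hNf0 hN hNf
  have hβ : 0 < β := KLRegimeSplit.pos_of_klBetaMin_le hβmin
  have hkJ : k ≤ J' := by omega
  have hc1 : c ≤ c₃ := hcm.trans ((min_le_left _ _).trans (min_le_left _ _))
  have hc2 : c ≤ c₃' := hcm.trans ((min_le_left _ _).trans (min_le_right _ _))
  have hc3 : c ≤ c₃'' := hcm.trans (min_le_right _ _)
  have hU1 : U ≤ U₀ := hUm.trans ((min_le_left _ _).trans (min_le_left _ _))
  have hU2 : U ≤ U₀' := hUm.trans ((min_le_left _ _).trans (min_le_right _ _))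
  have hU3 : U ≤ U₀'' := hUm.trans (min_le_right _ _)
  obtain ⟨_, hcol₁, hrow₁⟩ := hov P R c hP hR2 hc hc6 μ hμ U hU hU9 β hβmin hβc K hK L M hL3 hM3 k J' hJ hJN
  have hc₁0 : (0 : ℝ) ≤ 3 * CJ * M / β := by positivity
  have hBfib0 : 0 ≤ Bfib := le_trans (le_trans (sq_nonneg _) (le_max_left _ _)) hBfib
  -- the transversality radius in sector units, and the leg-dependent class ON ∩ NARROW
  set C' : ℕ := ⌊(Θ + 5 * sectorWidth k) / sectorWidth k⌋₊ with hC'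
  set B : Fin (m + 1) → Finset (Fin (m + 1) → SectorLeg (sectorCount k)) := fun p =>
    univ.filter fun σ' : Fin (m + 1) → SectorLeg (sectorCount k) =>
      (∃ G₀ : Fin 2 → ℤ, G₀ ≠ 0 ∧ ∀ j : Fin 2,
          |∑ i, (if (σ' i).2 = 0 then klFermiPoint μ K (sectorCenter k (σ' i).1.1) j
            else -klFermiPoint μ K (sectorCenter k (σ' i).1.1) j) - 2 * π * (G₀ j : ℝ)| ≤ ((m : ℝ) + 1) * C * sectorWidth k) ∧
      (∃ b : Fin (sectorCount k), ∀ i, i ≠ p → ∃ Dz : ℤ, |Dz| ≤ (C' : ℕ) ∧ ((2 : ℤ) ^ k) ∣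
        ((((if (σ' i).2 = 0 then ((σ' i).1.1 : ℕ) else
            if ((σ' i).1.1 : ℕ) < 2 ^ k then ((σ' i).1.1 : ℕ) + 2 ^ k else ((σ' i).1.1 : ℕ) - 2 ^ k : ℕ) : ℤ)) - b - Dz)) with hB
  -- the multiplicity and the on-class pinned bound
  set Mult : ℝ := (2 * ((m : ℝ) + 1) + 1) ^ 2 * (2 * (8 * π * (((m : ℝ) + 1) * C + m * Λ * (C' : ℕ)) / r₀ + 2) * (8 * (2 * ((C' : ℕ) : ℝ) + 1)) ^ m)
    with hMult
  have hMult0 : 0 ≤ Mult := by positivity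
  have hNB : ∀ (p : Fin (m + 1)) (ℓ : SectorLeg (sectorCount k)) (y : SpaceTimeIdx L M),
      imagTimeWeight β M ^ m *
        ∑ σ' ∈ (B p).filter (fun σ' : Fin (m + 1) → SectorLeg (sectorCount k) => σ' p = ℓ),
          ∑ x' ∈ univ.filter (fun x' : Fin (m + 1) → SpaceTimeIdx L M => x' p = y),
            ‖sectorisedKernel L M β (klAnisoFamily L M β μ K klE0 k) T (m + 1) σ' x'‖ ≤ Mult * Nf := by
    intro p ℓ y
    refine (pinnedClassSum_le_card_mul_of_full hβ μ K k T hT (B p) p ℓ y hNf).trans (mul_le_mul_of_nonneg_right ?_ hNf0)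
    -- the class with the pinned label fixed sits inside p4's summed narrow class
    have hcnt := hmult c hc hc3 U hU hU3 β hβmin hβc μ hμ μ K hK k m p ℓ C hC.le C' hsmallv hπC
    refine le_trans (Nat.cast_le.2 (card_le_card fun σ' hσ' => ?_)) hcnt
    simp only [hB, mem_filter, mem_univ, true_and] at hσ' ⊢
    obtain ⟨⟨⟨G₀, _, hG₀⟩, hnar⟩, hpℓ⟩ := hσ'
    exact ⟨hpℓ, ⟨G₀, hG₀⟩, hnar⟩
  have hA₁ : (0 : ℝ) ≤ (27 : ℝ) ^ (levelCount Ωe + 1) * (D₁ ^ (m + 1) + (5 : ℝ) ^ (m + 1) * ((m + 1 : ℕ) ^ 2 * (Bfib * 3 ^ (m - 2)))) *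
      ((2 : ℝ) ^ (J' - k)) ^ (m - 2) := by positivity
  have hA₂ : (0 : ℝ) ≤ D₂ * 27 ^ (m + 1) * ((2 : ℝ) ^ (J' - k)) ^ (m - levelCount Ωe) := by positivity
  have hMN : 0 ≤ Mult * Nf := mul_nonneg hMult0 hNf0
  have h := klLevNormOf_jump_le_split_of_consts_legClass hβ μ K hJ T hT hc₁0 hc₁0 hcol₁ hrow₁ m B Ωe hA₁ hA₂ hN0 hMN
    (fun E τ'' σ' p hp hσ' hFE hEF => ?_) (fun E τ'' σ' p hp _ hFE hEF => ?_) hN hNB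
  · have hMne : (M : ℝ) ≠ 0 := by exact_mod_cast NeZero.ne M
    have hεc : imagTimeWeight β M * (3 * CJ * M / β) = 3 * CJ / 2 := by
      unfold imagTimeWeight; field_simp
    have hconst : (3 * CJ * M / β) ^ m * (3 * CJ * M / β) * imagTimeWeight β M ^ (m + 1) = (3 * CJ / 2) ^ (m + 1) := by
      rw [← pow_succ, ← mul_pow, mul_comm (3 * CJ * M / β), hεc]
    calc klLevNormOf L M β μ K J' (m + 1) T Ωe
        ≤ (3 * CJ * M / β) ^ m * (3 * CJ * M / β) * imagTimeWeight β M ^ (m + 1) *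
            ((27 : ℝ) ^ (levelCount Ωe + 1) * (D₁ ^ (m + 1) + (5 : ℝ) ^ (m + 1) * ((m + 1 : ℕ) ^ 2 * (Bfib * 3 ^ (m - 2)))) *
                ((2 : ℝ) ^ (J' - k)) ^ (m - 2) * N +
              D₂ * 27 ^ (m + 1) * ((2 : ℝ) ^ (J' - k)) ^ (m - levelCount Ωe) * (Mult * Nf)) := h
      _ = (3 * CJ / 2) ^ (m + 1) *
            ((27 : ℝ) ^ (levelCount Ωe + 1) * (D₁ ^ (m + 1) + (5 : ℝ) ^ (m + 1) * ((m + 1 : ℕ) ^ 2 * (Bfib * 3 ^ (m - 2)))) *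
                ((2 : ℝ) ^ (J' - k)) ^ (m - 2) * N +
              D₂ * 27 ^ (m + 1) * ((2 : ℝ) ^ (J' - k)) ^ (m - levelCount Ωe) * Mult * Nf) := by rw [hconst]; ring
  · -- off the class `B p`: off the umklapp class, or on it for some `G₀ ≠ 0` and not narrow about `p` ⇒ wide
    have hnot : ¬ ((∃ G₀ : Fin 2 → ℤ, G₀ ≠ 0 ∧ ∀ j : Fin 2,
          |∑ i, (if (σ' i).2 = 0 then klFermiPoint μ K (sectorCenter k (σ' i).1.1) j
            else -klFermiPoint μ K (sectorCenter k (σ' i).1.1) j) - 2 * π * (G₀ j : ℝ)| ≤ ((m : ℝ) + 1) * C * sectorWidth k) ∧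
        (∃ b : Fin (sectorCount k), ∀ i, i ≠ p → ∃ Dz : ℤ, |Dz| ≤ (⌊(Θ + 5 * sectorWidth k) / sectorWidth k⌋₊ : ℕ) ∧ ((2 : ℤ) ^ k) ∣
          ((((if (σ' i).2 = 0 then ((σ' i).1.1 : ℕ) else
              if ((σ' i).1.1 : ℕ) < 2 ^ k then ((σ' i).1.1 : ℕ) + 2 ^ k else ((σ' i).1.1 : ℕ) - 2 ^ k : ℕ) : ℤ)) - b - Dz))) := by
      intro hh
      exact hσ' (by simp only [hB, mem_filter, mem_univ, true_and]; exact hh)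
    have hcnt := hoff' c hc hc1 U hU hU1 β hβmin hβc μ hμ μ K hK L M m k J' hk₀ hkJ hm hsmall _ subset_rfl E τ'' p hp σ'
      Θ LΨ Bfib hLΨ hΘt hΘδ hΘη hBfib hnot
    exact (mul_le_mul_of_nonneg_left hcnt (by positivity)).trans
      (offOrWide_count_arith hD₁.le hBfib0 (J' - k) m (levelCount Ωe) E.card hm hEF)
  · -- on the class: the one-determined-leg count
    have hcnt := hon' c hc hc2 U hU hU2 β hβmin hβc μ hμ μ K hK L M k J' hkJ _ subset_rfl E τ'' σ'
    exact (mul_le_mul_of_nonneg_left hcnt (by positivity)).trans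
      (legSet_count_arith hD₂.le (J' - k) m (levelCount Ωe) E.card hFE ((card_le_univ _).trans_eq (Fintype.card_fin _)))

end Summit.HubbardSuperconductivity.HubbardSuperconductivity.Theorems.EngineV8

end
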